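import Mathlib
import HarnessLib
import Summits.NavierStokesRegularity.NavierStokesRegularity.Theorems.TypeIQuarterGateScarEnvelopeTypeIForcedTsaiAlgNormalForm
import Summits.NavierStokesRegularity.NavierStokesRegularity.Theorems.TypeIQuarterGateScarEnvelopeTypeIForcedTsaiMoments

/-!
# ARM B lane E-exact, Type-I-tail class — MOMENT LEMMAS I (one-dimensional absolute Gaussian moments,
  coordinate-product integrals on `ℝ³`, real-rate monomial × Gaussian moments, `Γ(n/2) ↔ ghalf n`,
  Gamma subordination of the kernel `(1+|y|²/τ²)^{−r}`); used by `…AlgMoments` for the MOMENT IDENTITY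
  behind `Poly5.integrate`
  (`∫_{ℝ³} c·y^a·(1+|y|²/τ²)^{−h/2} dy = c·Πᵢ Γ((aᵢ+1)/2)·τ^{|a|+3}·Γ((h−|a|−3)/2)/Γ(h/2)` for `h > |a|+3`,
  by Gamma subordination `(1+u)^{−r} = Γ(r)^{−1}∫₀^∞ s^{r−1}e^{−s(1+u)}ds` of the `ℝ³` Gaussian moments
  of `…ForcedTsaiMoments`, Fubini on `ℝ³ × (0,∞)`), with integrability; the `Γ(n/2) ↔ ghalf n` bookkeeping;
  the list/pair bookkeeping of `Poly5.integrate`: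
  `Poly5.integrate τ P = some (c₁, c₂) → Integrable (Poly5.eval τ P) ∧ ∫ Poly5.eval τ P = c₁·π + c₂·π²`.
Nothing here bears on NS regularity.
-/

noncomputable section

set_option linter.dupNamespace false

namespace Summit.NavierStokesRegularity.NavierStokesRegularity.Cruxes.ScarEnvelopeTypeI.ForcedTsai

open MeasureTheory Set Metric Real Finset
open scoped RealInnerProductSpace

/-! ## One-dimensional absolute moments -/

/-- `∫_ℝ |x|ⁿ e^{−bx²} dx = b^{−(n+1)/2} Γ((n+1)/2)` (`b > 0`). [folklore] -/
theorem integral_abs_pow_mul_gauss1 (n : ℕ) {b : ℝ} (hb : 0 < b) :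
    ∫ x : ℝ, |x| ^ n * Real.exp (-b * x ^ 2) = b ^ (-((n : ℝ) + 1) / 2) * Real.Gamma (((n : ℝ) + 1) / 2) := by
  have h1 : (fun x : ℝ => |x| ^ n * Real.exp (-b * x ^ 2)) = fun x => (fun t : ℝ => t ^ n * Real.exp (-b * t ^ 2)) |x| := by
    funext x; simp only [sq_abs]
  rw [h1, integral_comp_abs (f := fun t : ℝ => t ^ n * Real.exp (-b * t ^ 2))]
  have h2 : ∫ x in Set.Ioi (0 : ℝ), x ^ n * Real.exp (-b * x ^ 2) =
      ∫ x in Set.Ioi (0 : ℝ), x ^ (n : ℝ) * Real.exp (-b * x ^ (2 : ℝ)) := by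
    refine setIntegral_congr_fun measurableSet_Ioi fun x _ => ?_
    rw [Real.rpow_natCast, Real.rpow_two]
  rw [h2, integral_rpow_mul_exp_neg_mul_rpow two_pos (by have := n.cast_nonneg (α := ℝ); linarith) hb]
  ring

/-- `x ↦ |x|ⁿ e^{−bx²}` is integrable (`b > 0`). [folklore] -/
theorem integrable_abs_pow_mul_gauss1 (n : ℕ) {b : ℝ} (hb : 0 < b) :
    Integrable fun x : ℝ => |x| ^ n * Real.exp (-b * x ^ 2) := by
  have h := (integrable_pow_mul_gauss1 n hb).norm
  refine h.congr (Filter.Eventually.of_forall fun x => ?_)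
  simp [norm_mul, norm_pow, Real.norm_eq_abs, abs_of_pos (Real.exp_pos _)]

/-! ## Product integrals over `ℝ³` -/

/-- A product of integrable coordinate functions is integrable on `ℝ³` and integrates to the product. [folklore] -/
theorem integral_prod3 (φ : Fin 3 → ℝ → ℝ) (hφ : ∀ j, Integrable (φ j)) :
    Integrable (fun y : E3 => ∏ j : Fin 3, φ j (y j)) ∧
      ∫ y : E3, ∏ j : Fin 3, φ j (y j) = ∏ j : Fin 3, ∫ t : ℝ, φ j t := by
  set e := MeasurableEquiv.toLp 2 (Fin 3 → ℝ) with he_def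
  have he : MeasurePreserving e volume volume := measurePreserving_toLp3
  set F : E3 → ℝ := fun y => ∏ j : Fin 3, φ j (y j) with hF
  have hcomp : (F ∘ e) = fun x : Fin 3 → ℝ => ∏ j : Fin 3, φ j (x j) := by
    funext x; simp [hF, Function.comp_apply, he_def]
  have hprodInt : Integrable (fun x : Fin 3 → ℝ => ∏ j : Fin 3, φ j (x j)) := by
    have := MeasureTheory.Integrable.fintype_prod (f := fun (j : Fin 3) (t : ℝ) => φ j t) hφ
    simpa [volume_pi] using this
  have hFe : Integrable (F ∘ e) := by rw [hcomp]; exact hprodInt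
  have hFint : Integrable F := (he.integrable_comp_emb e.measurableEmbedding).1 hFe
  refine ⟨hFint, ?_⟩
  have hval : ∫ y : E3, F y = ∫ x : Fin 3 → ℝ, (F ∘ e) x := (he.integral_comp' F).symm
  rw [hval, hcomp]
  have := MeasureTheory.integral_fintype_prod_eq_prod (𝕜 := ℝ) (fun (j : Fin 3) (t : ℝ) => φ j t) (μ := fun _ => volume)
  simpa [volume_pi] using this

/-- `Mono.eval m y · e^{−b|y|²}` is a coordinate product. [folklore] -/
theorem mono_gauss_eq_prod (m : Mono) (b : ℝ) (y : E3) :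
    Mono.eval m y * gauss b y = (m.c : ℝ) * ∏ j : Fin 3, ((y j) ^ m.exp j * Real.exp (-b * (y j) ^ 2)) := by
  rw [Mono.eval_eq_prod, gauss_eq_prod, Finset.prod_mul_distrib]; ring

/-- `|Mono.eval m y| · e^{−b|y|²}` is a coordinate product. [folklore] -/
theorem abs_mono_gauss_eq_prod (m : Mono) (b : ℝ) (y : E3) :
    |Mono.eval m y| * gauss b y = |(m.c : ℝ)| * ∏ j : Fin 3, (|y j| ^ m.exp j * Real.exp (-b * (y j) ^ 2)) := by
  rw [Mono.eval_eq_prod, gauss_eq_prod, abs_mul, Finset.abs_prod, Finset.prod_mul_distrib]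
  simp [abs_pow]; ring

/-- **Monomial × Gaussian, real rate**: integrable, and `∫ = c · Π_j ∫ x^{e_j} e^{−bx²}`. [folklore] -/
theorem integral_mono_gauss_real (m : Mono) {b : ℝ} (hb : 0 < b) :
    Integrable (fun y : E3 => Mono.eval m y * gauss b y) ∧
      ∫ y : E3, Mono.eval m y * gauss b y = (m.c : ℝ) * ∏ j : Fin 3, ∫ t : ℝ, t ^ m.exp j * Real.exp (-b * t ^ 2) := by
  obtain ⟨hi, hv⟩ := integral_prod3 (fun j t => t ^ m.exp j * Real.exp (-b * t ^ 2)) fun j => integrable_pow_mul_gauss1 _ hb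
  have hfun : (fun y : E3 => Mono.eval m y * gauss b y) =
      fun y => (m.c : ℝ) * ∏ j : Fin 3, ((y j) ^ m.exp j * Real.exp (-b * (y j) ^ 2)) :=
    funext fun y => mono_gauss_eq_prod m b y
  rw [hfun]
  exact ⟨hi.const_mul _, by rw [integral_const_mul, hv]⟩

/-- **|Monomial| × Gaussian, real rate**: `∫ |c y^a| e^{−b|y|²} = |c| Π_j b^{−(a_j+1)/2}Γ((a_j+1)/2)`. [folklore] -/
theorem integral_abs_mono_gauss_real (m : Mono) {b : ℝ} (hb : 0 < b) :
    Integrable (fun y : E3 => |Mono.eval m y| * gauss b y) ∧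
      ∫ y : E3, |Mono.eval m y| * gauss b y =
        |(m.c : ℝ)| * ∏ j : Fin 3, (b ^ (-((m.exp j : ℝ) + 1) / 2) * Real.Gamma (((m.exp j : ℝ) + 1) / 2)) := by
  obtain ⟨hi, hv⟩ := integral_prod3 (fun j t => |t| ^ m.exp j * Real.exp (-b * t ^ 2))
    fun j => integrable_abs_pow_mul_gauss1 _ hb
  have hfun : (fun y : E3 => |Mono.eval m y| * gauss b y) =
      fun y => |(m.c : ℝ)| * ∏ j : Fin 3, (|y j| ^ m.exp j * Real.exp (-b * (y j) ^ 2)) :=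
    funext fun y => abs_mono_gauss_eq_prod m b y
  rw [hfun]
  refine ⟨hi.const_mul _, ?_⟩
  rw [integral_const_mul, hv]
  congr 1
  exact Finset.prod_congr rfl fun j _ => integral_abs_pow_mul_gauss1 _ hb

/-! ## `Γ(n/2)` and the checker's `ghalf` -/

/-- `ghalf` on even arguments. -/
theorem ghalf_even (k : ℕ) : ghalf (2 * k) = ((k - 1).factorial : ℚ) := by
  unfold ghalf; rw [if_pos (by omega)]; congr 2; omega

/-- `ghalf` on odd arguments. -/
theorem ghalf_odd_cast (k : ℕ) : ((ghalf (2 * k + 1) : ℚ) : ℝ) = ∏ i ∈ range k, ((i : ℝ) + 1 / 2) := by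
  unfold ghalf
  rw [if_neg (by omega), show (2 * k + 1 - 1) / 2 = k by omega, foldl_mul_range_eq_prod, one_mul]
  push_cast
  exact Finset.prod_congr rfl fun i _ => by ring

/-- **`Γ(n/2)` through `ghalf`**: `Γ(n/2) = ghalf n · (√π if n is odd, else 1)` for `n ≥ 1`. [folklore] -/
theorem Gamma_half_eq_ghalf (n : ℕ) (hn : 1 ≤ n) :
    Real.Gamma ((n : ℝ) / 2) = (ghalf n : ℝ) * (if n % 2 = 1 then √π else 1) := by
  obtain ⟨k, hk | hk⟩ := Nat.even_or_odd' n
  · -- n = 2k, k ≥ 1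
    subst hk
    rw [if_neg (by omega), mul_one, ghalf_even]
    obtain ⟨j, rfl⟩ : ∃ j, k = j + 1 := ⟨k - 1, by omega⟩
    rw [show (((2 * (j + 1) : ℕ) : ℝ) / 2) = (j : ℝ) + 1 by push_cast; ring, Real.Gamma_nat_eq_factorial]
    simp
  · -- n = 2k+1
    subst hk
    rw [if_pos (by omega), ghalf_odd_cast, show (((2 * k + 1 : ℕ) : ℝ) / 2) = (k : ℝ) + 1 / 2 by push_cast; ring,
      Gamma_nat_add_half_eq_prod]
    ring

/-- Even 1-D moments through `ghalf`: `∫ x^{2k} e^{−bx²} = √π · ghalf(2k+1) · b^{−(2k+1)/2}`. [folklore] -/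
theorem integral_pow_even_gauss_ghalf (k : ℕ) {b : ℝ} (hb : 0 < b) :
    ∫ x : ℝ, x ^ (2 * k) * Real.exp (-b * x ^ 2) = √π * (ghalf (2 * k + 1) : ℝ) * b ^ (-(((2 * k : ℕ) : ℝ) + 1) / 2) := by
  rw [integral_pow_even_mul_gauss1 k hb, ghalf_odd_cast]
  set P : ℝ := ∏ i ∈ range k, ((i : ℝ) + 1 / 2) with hP
  have hprod : ∏ i ∈ range k, (2 * (i : ℝ) + 1) / (2 * b) = P / b ^ k := by
    have hterm : ∀ i ∈ range k, (2 * (i : ℝ) + 1) / (2 * b) = ((i : ℝ) + 1 / 2) / b := fun i _ => by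
      rw [div_eq_div_iff (by positivity) hb.ne']; ring
    rw [Finset.prod_congr rfl hterm, Finset.prod_div_distrib, Finset.prod_const, Finset.card_range]
  have hbk : b ^ (-(((2 * k : ℕ) : ℝ) + 1) / 2) = (√b * b ^ k)⁻¹ := by
    rw [show (-(((2 * k : ℕ) : ℝ) + 1) / 2) = -((k : ℝ) + 1 / 2) by push_cast; ring, Real.rpow_neg hb.le,
      Real.rpow_add hb, Real.rpow_natCast, show b ^ (1 / 2 : ℝ) = √b by rw [Real.sqrt_eq_rpow]]
    ring
  rw [hprod, Real.sqrt_div' _ hb.le, hbk]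
  have hsb : 0 < √b := Real.sqrt_pos.2 hb
  field_simp

/-! ## Gamma subordination of the kernel -/

/-- `(kbase)^{−r} = Γ(r)^{−1} ∫₀^∞ s^{r−1} e^{−kbase·s} ds` (`r > 0`). [folklore] -/
theorem kbase_rpow_neg_eq_integral (τ : ℝ) (y : E3) {r : ℝ} (hr : 0 < r) :
    kbase τ y ^ (-r) = (Real.Gamma r)⁻¹ * ∫ s in Ioi (0 : ℝ), s ^ (r - 1) * Real.exp (-(kbase τ y * s)) := by
  have hk := kbase_pos τ y
  rw [Real.integral_rpow_mul_exp_neg_mul_Ioi hr hk, one_div, Real.inv_rpow hk.le, Real.rpow_neg hk.le]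
  have hG := (Real.Gamma_pos_of_pos hr).ne'
  field_simp

/-- `e^{−kbase·s} = e^{−s} · e^{−(s/τ²)|y|²}`. -/
theorem exp_neg_kbase_mul (τ : ℝ) (y : E3) (s : ℝ) :
    Real.exp (-(kbase τ y * s)) = Real.exp (-s) * gauss (s / τ ^ 2) y := by
  rw [gauss, ← Real.exp_add, kbase]; ring_nf

end Summit.NavierStokesRegularity.NavierStokesRegularity.Cruxes.ScarEnvelopeTypeI.ForcedTsai

end
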